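import Summits.QuantumFields.BalabanUV.Beta.EriceRemainderEnclosureHistoryAutonomyWellPosed

/-!
# EriceRemainderEnclosureHistoryAutonomyDegree — (E37g) THE DEGREE OF THE AUTONOMY THRESHOLD: the floor-using zeroth-moment criterion
# `M·γ < b` of (E37b) is SHARP IN DEGREE ONE IN γ — along node U2's ramp family (`T4BetaFlowWellPosed.Sharpness.rampFn` on its diagonal
# `θ = 1 − 1∕(2K)`, `Y = 8K`, box ]0, (8K)^{−1∕2}], floor `1`) the zeroth moment `M = Cm∕(1−θ)` has `M·γ ≤ 200 = 200·b` while `γ → 0` and TWO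
# box solutions persist; so the threshold `τ* = inf {M·γ∕b : non-unique instances}` obeys `1 ≤ τ*` ((E37b)), `τ* ≤ 10` (node U2's Markov bump,
# γ = 1) and STAYS `≤ 200` as `γ → 0`: no criterion `M·γ·φ(γ) < b` with `φ(γ) → 0` holds — in contrast with the MARKOV sub-class, where
# `M·γ³ < 2` suffices (node U2's `memFlow_unique_of_shortMemory_markovDegree`)

Cell `pub-balaban`, β-function sub-cell, BINDER row D4 «RemainderConst leaves for Bałaban's split» (`HOME/BINDER-OWNERS.md`; owner
lineage `b2b-balaban-beta-an4`; this file by co-owner #2 lineage `b2b-balaban-beta-d4-p2`, generation 39), β-FLOW TEAM duty (1),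
FREEZE (0) honoured (def-free; node U2's `Sharpness.rampFn` ∕ `rampCm` ∕ `hRampS` ∕ `hRampF` and their theorems `memoryProfile_rampFn`,
`memFlow_hRampS`, `memFlow_hRampF`, `hRampS_ne_hRampF`, `seqBox_hRamp*`, `one_le_rampFn`, `rampCm_mul_cube_le_diag`, and the bump
`memoryProfile_bumpB` ∕ `memFlow_hSlow` ∕ `memFlow_hFast` ∕ `hSlow_ne_hFast` BY NAME; (E37b) `zerothMoment_of_memoryProfile` ∕ `memFlow_unique_zm`).
Companion of (E37b) `EriceRemainderEnclosureHistoryAutonomyWellPosed` (imported) and (E37d)∕(E37e).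

HONEST FRAMING (page 1, verbatim and binding).  *"Discharging BetaPertH makes Bałaban's UV stability UNCONDITIONAL — a real
constructive-QFT result; it is NOT the continuum limit and NOT the Clay problem."*  THIS FILE DISCHARGES NOTHING OF THE KIND.  Kernel
WITNESSES about the hypothesis class of a kernel theorem ((E37b) `memFlow_unique_zm`); toy functionals, NOT Bałaban's (1.22) or its limit
functional, about whose modulus nothing is printed ([I] p. 298, qualitative) or asserted.  Row D4 class UNCHANGED (critical-path width 0;
instance 0∕1; D4 DISCHARGE NO DATE).  HONEST DEPENDENCY: continuum YM on T⁴ ⇐ BetaPertH ∧ nine spine estimates (0/9 proved); BetaPertH ⇐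
(D1) ∧ (D4) ∧ CAP+tail; G-an2-4 gates asym, D1 and NE2/3/4.

THE POINT (census sense (α); the AUTONOMY row's well-posedness cell, DEGREE).  (E37b): zeroth moment `M`, floor `b`, `M·γ < b` ⟹ the flow
with memory has exactly one box solution per pin.  For MARKOV functionals node U2 has the floor-FREE criterion `M·γ³ < 2` (§9
`memFlow_unique_of_shortMemory_markovDegree`, θ = 0), much weaker at small γ; for genuine memory node U2's §9 decides the FLOOR-FREE
threshold in the currency `Cm·γ³` against the FIRST moment (degree 2 in `1−θ`).  THIS FILE reads node U2's ramp family in the FLOOR-USING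
zeroth-moment currency of (E37b): §1 on the diagonal the zeroth moment `M = rampCm∕(1−θ) = 2K·rampCm` has `M·γ = 16K²·(rampCm·γ³) ≤
16K²·25∕(2K(K+1)) ≤ 200` (`rampM_mul_gamma_le_diag`) while `γ = (8K)^{−1∕2}`; §2 hence for every `ε > 0` an instance with `γ < ε`, floor `b = 1`,
zeroth moment `M` with `M·γ ≤ 200·b`, and two distinct box solutions from the pin `γ` (`exists_memFlow_ne_smallGamma_boundedRatio`) —
(E37b)'s `memFlow_unique_zm` with `hsmall : M·γ < b` weakened to `M·γ ≤ 200·b ∧ γ < ε` is FALSE for every ε (`memFlow_unique_zm_false_ratio200`);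
§3 the other side BY NAME: every non-unique instance has `b ≤ M·γ` (`ratio_ge_one_of_two_solutions`), and node U2's Markov bump is a
non-unique instance with `M·γ = 10·b` at γ = 1 (`bump_ratio_ten`).  So the floor-using threshold constant lies in `[1, 10]` and the DEGREE in γ is
EXACTLY ONE: long memory (K bumps over the first K ages, K ≍ 1∕γ²) defeats every `γ`-improvement of the criterion that the Markov class
enjoys.  What is NOT claimed: the exact constant; anything about Bałaban's functional.

WHAT IS PROVED ([folklore]; 0 `def`, 0 sorry).  §1 `inv_sqrt_sq`, **`rampM_mul_gamma_le_diag`**.  §2 **`exists_memFlow_ne_smallGamma_boundedRatio`**,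
**`memFlow_unique_zm_false_ratio200`**.  §3 `ratio_ge_one_of_two_solutions`, `bump_ratio_ten`.
-/

noncomputable section
open Filter Topology Finset

namespace Summit.QuantumFields.BalabanUV.Beta.EriceRemainderEnclosureHistoryAutonomyDegree

open Literature.MathematicalPhysics.QuantumFieldTheory.Balaban1983to89
open Literature.MathematicalPhysics.QuantumFieldTheory.Balaban1983to89.T4BetaStationary
open Literature.MathematicalPhysics.QuantumFieldTheory.Balaban1983to89.T4BetaFlowWellPosed
open Literature.MathematicalPhysics.QuantumFieldTheory.Balaban1983to89.T4BetaFlowWellPosed.Sharpness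
open Summit.QuantumFields.BalabanUV.Beta.EriceRemainderEnclosureHistoryAutonomyWellPosed

/-! ## §1 The zeroth moment of node U2's ramp functional on the diagonal: `M·γ ≤ 200` -/

/-- `(1∕√x)² = 1∕x` for `x > 0`. [folklore] -/
theorem inv_sqrt_sq {x : ℝ} (hx : 0 < x) : (1 / Real.sqrt x) ^ 2 = 1 / x := by
  rw [div_pow, one_pow, Real.sq_sqrt hx.le]

/-- **ON THE DIAGONAL `θ = 1 − 1∕(2K)`, `Y = 8K`, `γ = (8K)^{−1∕2}`: the ZEROTH MOMENT `M = rampCm∕(1−θ)` of node U2's ramp functional has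
`M·γ ≤ 200`** (from node U2's `rampCm_mul_cube_le_diag`: `rampCm·γ³ ≤ 25∕(2K(K+1))`, with `γ² = 1∕(8K)` and `1∕(1−θ) = 2K`). [folklore] -/
theorem rampM_mul_gamma_le_diag {K : ℕ} (hK : 0 < K) :
    rampCm K (1 - 1 / (2 * (K : ℝ))) (8 * K) / (1 - (1 - 1 / (2 * (K : ℝ)))) * (1 / Real.sqrt (8 * (K : ℝ))) ≤ 200 := by
  have hKr : (0 : ℝ) < K := Nat.cast_pos.2 hK
  set γ : ℝ := 1 / Real.sqrt (8 * (K : ℝ)) with hγ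
  set Cm : ℝ := rampCm K (1 - 1 / (2 * (K : ℝ))) (8 * K) with hCm
  have hγ0 : 0 < γ := one_div_pos.2 (Real.sqrt_pos.2 (by positivity))
  have hγ2 : γ ^ 2 = 1 / (8 * (K : ℝ)) := inv_sqrt_sq (by positivity)
  have hcube : Cm * γ ^ 3 ≤ 25 / (2 * ((K : ℝ) * (K + 1))) := rampCm_mul_cube_le_diag hK
  have e1 : (1 : ℝ) - (1 - 1 / (2 * K)) = 1 / (2 * K) := by ring
  rw [e1]
  -- M·γ = 2K·Cm·γ = 16K²·(Cm·γ³)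
  have e2 : Cm / (1 / (2 * (K : ℝ))) * γ = 16 * (K : ℝ) ^ 2 * (Cm * γ ^ 3) := by
    have : γ ^ 3 = γ * γ ^ 2 := by ring
    rw [this, hγ2]
    field_simp
    ring
  rw [e2]
  calc 16 * (K : ℝ) ^ 2 * (Cm * γ ^ 3) ≤ 16 * (K : ℝ) ^ 2 * (25 / (2 * ((K : ℝ) * (K + 1)))) :=
        mul_le_mul_of_nonneg_left hcube (by positivity)
    _ = 200 * ((K : ℝ) / (K + 1)) := by field_simp; ring
    _ ≤ 200 * 1 := mul_le_mul_of_nonneg_left ((div_le_one (by positivity)).2 (by linarith)) (by norm_num)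
    _ = 200 := by ring

/-! ## §2 Non-uniqueness with `M·γ ≤ 200·b` at arbitrarily small `γ` -/

/-- **FOR EVERY `ε > 0`: a functional with ZEROTH MOMENT `M ≥ 0` on the box ]0,γ], floor `1`, with `γ < ε`, `M·γ ≤ 200`, and TWO DISTINCT box
solutions of its flow with memory from the pin `γ`** — node U2's ramp family at `K > 1∕(8ε²)`, its profile read as a zeroth moment by
(E37b) `zerothMoment_of_memoryProfile`. [folklore] -/
theorem exists_memFlow_ne_smallGamma_boundedRatio (ε : ℝ) (hε : 0 < ε) :
    ∃ (B : (ℕ → ℝ) → ℝ) (M γ : ℝ) (h h' : ℕ → ℝ), 0 ≤ M ∧ 0 < γ ∧ γ < ε ∧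
      (∀ u u' : ℕ → ℝ, SeqBox γ u → SeqBox γ u' → ∀ D : ℝ, (∀ j, |u j - u' j| ≤ D) → |B u - B u'| ≤ M * D) ∧
      (∀ u, SeqBox γ u → 1 ≤ B u) ∧ M * γ ≤ 200 ∧
      SeqBox γ h ∧ SeqBox γ h' ∧ MemFlow B γ h ∧ MemFlow B γ h' ∧ h ≠ h' := by
  obtain ⟨K, hK⟩ : ∃ K : ℕ, 1 / (8 * ε ^ 2) < K := exists_nat_gt _
  have hKr : (0 : ℝ) < K := lt_trans (by positivity) hK
  have hKpos : 0 < K := Nat.cast_pos.1 hKr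
  have hK1 : (1 : ℝ) ≤ K := by exact_mod_cast hKpos
  have hθ0 : (0 : ℝ) ≤ 1 - 1 / (2 * K) := by
    rw [sub_nonneg, div_le_one (by positivity)]; linarith
  have hθ1 : 1 - 1 / (2 * (K : ℝ)) < 1 := by
    have : 0 < 1 / (2 * (K : ℝ)) := by positivity
    linarith
  have hY : (1 : ℝ) ≤ 8 * K := by linarith
  have h1θ : 0 < 1 - (1 - 1 / (2 * (K : ℝ))) := by linarith
  set θ : ℝ := 1 - 1 / (2 * (K : ℝ)) with hθ
  set γ : ℝ := 1 / Real.sqrt (8 * (K : ℝ)) with hγ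
  have hγ0 : 0 < γ := one_div_pos.2 (Real.sqrt_pos.2 (by positivity))
  have hγε : γ < ε := by
    -- γ² = 1/(8K) < ε²
    have hγ2 : γ ^ 2 = 1 / (8 * (K : ℝ)) := inv_sqrt_sq (by positivity)
    have hlt : γ ^ 2 < ε ^ 2 := by
      rw [hγ2, div_lt_iff₀ (by positivity)]
      have := (div_lt_iff₀ (by positivity : (0 : ℝ) < 8 * ε ^ 2)).1 hK
      nlinarith
    exact lt_of_pow_lt_pow_left₀ 2 hε.le hlt
  have hCm0 : 0 ≤ rampCm K θ (8 * K) := (rampCm_pos hKpos hθ0 hY).le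
  refine ⟨rampFn K θ (8 * K), rampCm K θ (8 * K) / (1 - θ), γ, hRampS (8 * K), hRampF K (8 * K),
    div_nonneg hCm0 h1θ.le, hγ0, hγε,
    zerothMoment_of_memoryProfile (memoryProfile_rampFn hKpos hθ0 hθ1 hY γ) hCm0 hθ0 hθ1,
    fun u _ => one_le_rampFn hKpos u, rampM_mul_gamma_le_diag hKpos,
    seqBox_hRampS hY, seqBox_hRampF hKpos hY, memFlow_hRampS hKpos hθ0 hY, memFlow_hRampF hKpos hθ0 hY,
    hRampS_ne_hRampF hKpos hY⟩

/-- **(E37b)'s `memFlow_unique_zm` WITH `hsmall : M·γ < b` WEAKENED TO `M·γ ≤ 200·b ∧ γ < ε` IS FALSE, FOR EVERY `ε > 0`** — neither a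
larger constant nor the smallness of γ rescues uniqueness: the degree of the floor-using criterion in γ is exactly one. [folklore] -/
theorem memFlow_unique_zm_false_ratio200 (ε : ℝ) (hε : 0 < ε) :
    ¬ (∀ (B : (ℕ → ℝ) → ℝ) (M γ b gIR : ℝ) (h h' : ℕ → ℝ),
        (∀ u u' : ℕ → ℝ, SeqBox γ u → SeqBox γ u' → ∀ D : ℝ, (∀ j, |u j - u' j| ≤ D) → |B u - B u'| ≤ M * D) →
        0 ≤ M → 0 < gIR → gIR ≤ γ → 0 < b → (∀ u, SeqBox γ u → b ≤ B u) → M * γ ≤ 200 * b → γ < ε →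
        SeqBox γ h → SeqBox γ h' → MemFlow B gIR h → MemFlow B gIR h' → h = h') := fun H => by
  obtain ⟨B, M, γ, h, h', hM, hγ, hγε, hB, hfl, hratio, hh, hh', hf, hf', hne⟩ :=
    exists_memFlow_ne_smallGamma_boundedRatio ε hε
  exact hne (H B M γ 1 γ h h' hB hM hγ le_rfl one_pos hfl (by linarith) hγε hh hh' hf hf')

/-! ## §3 The other side: every non-unique instance has `b ≤ M·γ`; node U2's bump sits at `M·γ = 10·b` -/

/-- **LOWER SIDE OF THE THRESHOLD** ((E37b) `memFlow_unique_zm`, contrapositive): two distinct box solutions from one pin force `b ≤ M·γ`.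
[folklore] -/
theorem ratio_ge_one_of_two_solutions {B : (ℕ → ℝ) → ℝ} {M γ b gIR : ℝ} {h h' : ℕ → ℝ}
    (hB : ∀ u u' : ℕ → ℝ, SeqBox γ u → SeqBox γ u' → ∀ D : ℝ, (∀ j, |u j - u' j| ≤ D) → |B u - B u'| ≤ M * D)
    (hM : 0 ≤ M) (hgIR : 0 < gIR) (hgIRγ : gIR ≤ γ) (hb : 0 < b) (hlo : ∀ u, SeqBox γ u → b ≤ B u)
    (hh : SeqBox γ h) (hh' : SeqBox γ h') (hf : MemFlow B gIR h) (hf' : MemFlow B gIR h') (hne : h ≠ h') :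
    b ≤ M * γ :=
  not_lt.1 fun hsmall => hne (memFlow_unique_zm hB hM hgIR hgIRγ hb hlo hsmall hh hh' hf hf')

/-- **NODE U2's MARKOV BUMP IN THE ZEROTH-MOMENT CURRENCY**: zeroth moment `20` on ]0,1], floor `2`, pin `1`, two box solutions — an
instance with `M·γ = 10·b` (its `memoryProfile_bumpB` at θ = 0 read by `zerothMoment_of_memoryProfile`). [folklore] -/
theorem bump_ratio_ten :
    (∀ u u' : ℕ → ℝ, SeqBox 1 u → SeqBox 1 u' → ∀ D : ℝ, (∀ j, |u j - u' j| ≤ D) → |bumpB u - bumpB u'| ≤ 20 * D) ∧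
    (∀ u, SeqBox 1 u → (2 : ℝ) ≤ bumpB u) ∧ SeqBox 1 hSlow ∧ SeqBox 1 hFast ∧ MemFlow bumpB 1 hSlow ∧ MemFlow bumpB 1 hFast ∧
    hSlow ≠ hFast ∧ (20 : ℝ) * 1 = 10 * 2 := by
  refine ⟨fun u u' hu hu' D hD => ?_, fun u _ => le_bumpB u, seqBox_hSlow, seqBox_hFast, memFlow_hSlow, memFlow_hFast,
    hSlow_ne_hFast, by norm_num⟩
  have h := zerothMoment_of_memoryProfile (memoryProfile_bumpB le_rfl zero_lt_one) (by norm_num) le_rfl zero_lt_one u u' hu hu' D hD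
  simpa using h

end Summit.QuantumFields.BalabanUV.Beta.EriceRemainderEnclosureHistoryAutonomyDegree

end
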